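import Mathlib
import Summits.ValiantsHypothesis.ValiantsHypothesis.Theses.FifoMatching
import Summits.ValiantsHypothesis.ValiantsHypothesis.Theorems.FifoMatchingNNLinearDegreeCofactorHardOfPricingA
import HarnessLib

/-!
# Route `FifoMatching`, crux `NNInternalCofactorQuasiPolyHard` (stmt-ValiantsHypothesis-24468, SPEC §S11, exponent 2):
# S11 A FORTIORI from the SAME counts / pricing hypothesis that closes the ∀c crux `NNLinearDegreeCofactorHard`
# (stmt-ValiantsHypothesis-23918, line `internal_cofactor`, μ* = `shedWord`)

Glue only (helper for stmt-24468).  VERBATIM the two sorry-free theorems of val-idea-7 g5's registered crux line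
`Cruxes/NNInternalCofactorQuasiPolyHard/Lines/afortiori.lean` (2026-08-28, @fd0cd36b8ccf; observation and proofs are val-idea-7's),
moved to the `Theorems` namespace so that the closing files can import them:

* `nnInternalCofactorQuasiPolyHard_of_avoidingCounts a ha h` — S11 from the ∀c avoiding counts at density `a ≥ 28`, i.e. from
  EXACTLY the hypothesis `h` of `InternalCofactor.nnLinearDegreeCofactorHard_of_avoidingCounts a ha` (p605054 `…OfPricingA`).
  S11 is NOT a formal corollary of the crux 23918 as typed (23918 carries `+ L₊(h)` and `a·deg h ≤ n`), but it IS a corollary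
  of the same HYPOTHESIS: the dense branch goes through p3's degree-free per-instance `InternalCofactor.lt_complexity_of_counts`
  (any threshold `K`), the long-run branch through S2a `stub_longRunInternalHard` (landed, no density / degree hypothesis), both
  at `c = 2`, and `(log₂ n)² / 1 ≤ (log₂ n + 2)²`; so `b = 1`.
* `nnInternalCofactorQuasiPolyHard_of_pricing a ha r hμ hr` — the same from a pricing (SAME `hμ`/`hr` as
  `InternalCofactor.avoidingCounts_of_pricing a ha r`).

Consequence: ONE discharge of the counts (the acting LEAD's unit (D) for μ* = shedWord at `a = 1024`) closes BOTH rungs by one line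
each: `InternalCofactor.nnLinearDegreeCofactorHard_of_avoidingCounts 1024 _ hD` (23918) and
`AFortiori.nnInternalCofactorQuasiPolyHard_of_avoidingCounts 1024 _ hD` (24468).

Honest framing: CONDITIONAL assembly (hypothesis = the counts / the pricing); nothing here proves the counts, S2b, 23918, 24468,
`NNDivisionHard`, `NNNotVP` or VP ≠ VNP (NOT proved; monotone world only).  No definitions, no named facts. [folklore]
-/

noncomputable section

-- Sub = Summit single-conjunct layout: the duplicated namespace component is mandated by the tree.
set_option linter.dupNamespace false

namespace Summit.ValiantsHypothesis.ValiantsHypothesis.Theorems.FifoMatching.NNInternalCofactorQuasiPolyHard.AFortiori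

open MvPolynomial Finset Literature.Computability.AlgebraicComplexity
open Summit.ValiantsHypothesis.ValiantsHypothesis.Theorems.FifoMatching.NNLowDegreeCofactorHard.FreedVertices.Carve
open Summit.ValiantsHypothesis.ValiantsHypothesis.Theorems.FifoMatching.NNLinearDegreeCofactorHard
open Summit.ValiantsHypothesis.ValiantsHypothesis.Theorems.FifoMatching.NNLinearDegreeCofactorHard.InternalCofactor
open scoped NNReal

/-- **S11 (`NNInternalCofactorQuasiPolyHard`, stmt-24468) from the avoiding counts at density `a ≥ 28`** — the SAME
hypothesis as `InternalCofactor.nnLinearDegreeCofactorHard_of_avoidingCounts a ha` (∀c counts for run-free admissible `R`).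
Proof: instance `c = 2`; long-run `R` by S2a `stub_longRunInternalHard 2`; run-free `R` by `lt_complexity_of_counts` with
`K = 2^((log₂ n + 2)²)`; then `2^((log₂ n)²/1) ≤ K`.  Gives the crux's `∃ a b n₀` with `b = 1`. [folklore] -/
theorem nnInternalCofactorQuasiPolyHard_of_avoidingCounts (a : ℕ) (ha : 28 ≤ a)
    (h : ∀ c : ℕ, ∃ n₀ : ℕ, ∀ n ≥ n₀, ∀ R : Finset (Fin (2 * n)), a * R.card ≤ 2 * n →
      (¬ ∃ s : ℕ, s + (2 * ((Nat.log 2 n + c) ^ c + Nat.log 2 n + 1) ^ 6 + 12) ≤ 2 * n ∧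
        ∀ j : Fin (2 * n), s ≤ j.val →
          j.val < s + (2 * ((Nat.log 2 n + c) ^ c + Nat.log 2 n + 1) ^ 6 + 12) → j ∉ R) →
      ∀ C : Carving n, 3 ≤ C.m → 2 * n ≤ 2 * C.m + 12 * R.card + 4 →
        (∀ t ≤ 2 * C.m,
          4 * ((univ.filter fun j : Fin (2 * C.m) => C.up j ∈ R).filter fun j => j.val < t).card ≤ t ∧
          4 * ((univ.filter fun j : Fin (2 * C.m) => C.up j ∈ R).filter
            fun j => 2 * C.m ≤ j.val + t).card ≤ t) →
        ∃ B : ℕ, ∃ BB : Finset (Fin B → Bool), ∃ f : (Fin B → Bool) → (Fin (2 * C.m) → Fin (2 * C.m)),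
          BB.Nonempty ∧
          (∀ y ∈ BB, f y ∈ (nestFreeMatchings (2 * C.m)).filter
            (fun N => ∀ j ∈ (univ.filter fun j : Fin (2 * C.m) => C.up j ∈ R),
              N j ∉ (univ.filter fun j : Fin (2 * C.m) => C.up j ∈ R))) ∧
          ∀ S : Finset (Fin (2 * C.m)), 2 * C.m < 3 * S.card → 3 * S.card ≤ 4 * C.m →
            (4 * (2 ^ ((Nat.log 2 n + c) ^ c) + 1) * (C.m + 1) ^ 2) *
              (BB.filter fun y => ∀ i, i ∈ S ↔ f y i ∈ S).card < BB.card) :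
    ∃ a b n₀ : ℕ, 0 < b ∧ ∀ n ≥ n₀, ∀ R : Finset (Fin (2 * n)), a * R.card ≤ 2 * n →
        ∀ p : MvPolynomial (Fin (2 * n) × Fin (2 * n)) NNReal, p ≠ 0 →
          (∀ d ∈ p.support, ∀ e ∈ d.support, e.1 ∈ R ∧ e.2 ∈ R) →
          2 ^ ((Nat.log 2 n) ^ 2 / b) < Literature.Computability.AlgebraicComplexity.complexity
            ((∑ M : Fin (2 * n) → Fin (2 * n), if ((∀ i, M (M i) = i) ∧ (∀ i, M i ≠ i) ∧
                ∀ i j, i < j → j < M j → M j < M i → False) then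
                ∏ i : Fin (2 * n), (if i < M i then MvPolynomial.X (i, M i) else 1)
              else (0 : MvPolynomial (Fin (2 * n) × Fin (2 * n)) NNReal)) * p) := by
  show Summit.ValiantsHypothesis.ValiantsHypothesis.Theses.FifoMatching.NNInternalCofactorQuasiPolyHard
  classical
  obtain ⟨n₁, hn₁⟩ := stub_longRunInternalHard 2
  obtain ⟨n₂, hn₂⟩ := h 2
  refine ⟨a, 1, max (max n₁ n₂) 5, Nat.one_pos, fun n hn R hR p hp hint => ?_⟩
  have hn5 : 5 ≤ n := le_of_max_le_right hn
  have hn₁' : n₁ ≤ n := (le_max_left _ _).trans (le_of_max_le_left hn)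
  have hn₂' : n₂ ≤ n := (le_max_right _ _).trans (le_of_max_le_left hn)
  have hR14 : 14 * R.card + 10 ≤ 2 * n := by
    have h1 : 28 * R.card ≤ 2 * n := (Nat.mul_le_mul_right _ ha).trans hR
    omega
  show 2 ^ ((Nat.log 2 n) ^ 2 / 1) < complexity (nestFreeMatchingPoly n ℝ≥0 * p)
  have hK : 2 ^ ((Nat.log 2 n) ^ 2 / 1) ≤ 2 ^ ((Nat.log 2 n + 2) ^ 2) := by
    apply Nat.pow_le_pow_right (by norm_num)
    rw [Nat.div_one]
    exact Nat.pow_le_pow_left (Nat.le_add_right _ _) 2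
  refine lt_of_le_of_lt hK ?_
  by_cases hrun : ∃ s : ℕ, s + (2 * ((Nat.log 2 n + 2) ^ 2 + Nat.log 2 n + 1) ^ 6 + 12) ≤ 2 * n ∧
      ∀ j : Fin (2 * n), s ≤ j.val →
        j.val < s + (2 * ((Nat.log 2 n + 2) ^ 2 + Nat.log 2 n + 1) ^ 6 + 12) → j ∉ R
  · exact hn₁ n hn₁' R hrun p hp hint
  · exact lt_complexity_of_counts R hR14 _ hp hint
      (fun C hm3 hsize hS0 => hn₂ n hn₂' R hR hrun C hm3 hsize hS0)

/-- **S11 from a pricing at density `a ≥ 28`** — the SAME hypotheses `hμ` (pricing of the respecting seeds with rate `r`)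
and `hr` (rate growth) as `InternalCofactor.avoidingCounts_of_pricing a ha r`; for μ* = `shedWord` the acting LEAD's unit (D)
supplies them at `a = 1024`.  [folklore] -/
theorem nnInternalCofactorQuasiPolyHard_of_pricing (a : ℕ) (ha : 28 ≤ a) (r : ℕ → ℕ)
    (hμ : ∀ n : ℕ, ∀ R : Finset (Fin (2 * n)), a * R.card ≤ 2 * n →
      ∀ C : Carving n, 3 ≤ C.m → 2 * n ≤ 2 * C.m + 12 * R.card + 4 →
        (∀ t ≤ 2 * C.m,
          4 * ((univ.filter fun j : Fin (2 * C.m) => C.up j ∈ R).filter fun j => j.val < t).card ≤ t ∧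
          4 * ((univ.filter fun j : Fin (2 * C.m) => C.up j ∈ R).filter
            fun j => 2 * C.m ≤ j.val + t).card ≤ t) →
        ∃ B : ℕ, ∃ BB : Finset (Fin B → Bool), ∃ f : (Fin B → Bool) → (Fin (2 * C.m) → Fin (2 * C.m)),
          BB.Nonempty ∧
          (∀ y ∈ BB, f y ∈ (nestFreeMatchings (2 * C.m)).filter
            (fun N => ∀ j ∈ (univ.filter fun j : Fin (2 * C.m) => C.up j ∈ R),
              N j ∉ (univ.filter fun j : Fin (2 * C.m) => C.up j ∈ R))) ∧
          (2 : ℝ) ^ B ≤ 2 * BB.card ∧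
          ∀ S : Finset (Fin (2 * C.m)), 2 * C.m < 3 * S.card → 3 * S.card ≤ 4 * C.m →
            ((BB.filter fun y => ∀ i, i ∈ S ↔ f y i ∈ S).card : ℝ) * (4 / 3 : ℝ) ^ (r C.m) ≤ 2 ^ B)
    (hr : ∀ c : ℕ, ∃ n₀ : ℕ, ∀ n ≥ n₀, ∀ M : ℕ, n ≤ 14 * (M + 2) →
      (8 * (2 ^ ((Nat.log 2 n + c) ^ c) + 1) * (M + 1) ^ 2 : ℝ) * (3 / 4 : ℝ) ^ (r M) < 1) :
    ∃ a b n₀ : ℕ, 0 < b ∧ ∀ n ≥ n₀, ∀ R : Finset (Fin (2 * n)), a * R.card ≤ 2 * n →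
        ∀ p : MvPolynomial (Fin (2 * n) × Fin (2 * n)) NNReal, p ≠ 0 →
          (∀ d ∈ p.support, ∀ e ∈ d.support, e.1 ∈ R ∧ e.2 ∈ R) →
          2 ^ ((Nat.log 2 n) ^ 2 / b) < Literature.Computability.AlgebraicComplexity.complexity
            ((∑ M : Fin (2 * n) → Fin (2 * n), if ((∀ i, M (M i) = i) ∧ (∀ i, M i ≠ i) ∧
                ∀ i j, i < j → j < M j → M j < M i → False) then
                ∏ i : Fin (2 * n), (if i < M i then MvPolynomial.X (i, M i) else 1)
              else (0 : MvPolynomial (Fin (2 * n) × Fin (2 * n)) NNReal)) * p) :=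
  nnInternalCofactorQuasiPolyHard_of_avoidingCounts a ha (avoidingCounts_of_pricing a ha r hμ hr)

end Summit.ValiantsHypothesis.ValiantsHypothesis.Theorems.FifoMatching.NNInternalCofactorQuasiPolyHard.AFortiori

end
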